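import Summits.QuantumFields.BalabanUV.T4Continuum.Support.NE3LandauOrbit
import Summits.QuantumFields.BalabanUV.T4Continuum.Support.NE3SlicePoincareAssembly
import Summits.QuantumFields.BalabanUV.T4Continuum.Support.AveragingDeficitHSInner
import HarnessLib

/-!
# T⁴ programme, node NE3, row E-MLw-(w4)-P · Φ5-ORTH — THE CURVED MIN-NORM SLICE AND THE CURVED CORNER SPIKES,
# EXACT AT ANY UNITARY BACKGROUND (the `W ≠ 1` twin of H5a §1–§3 in Hilbert–Schmidt currency)

NE3 formalisation swarm `b2b-balaban-t4-ne3-formalise-*`, LEAF PROVER 04 (gen 5), row Φ5 «CURVED: kinematics on T_♮(W)∕T(W)» of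
`t4/formal/NE3/LEAVES.md` (owner `t4-ne3-p1` rulings ρ-g21-4 (W2) «the chart's slice for curl-currency statements = the ℓ²-MIN-NORM slice
T(W) = projected Landau», ρ-g22-1 (R1) «slice clause of record: divergence zero OFF the block corners», finding F-ne3p1-g21-1 §3 «Exact at
any W: the split (Landau rel. W), orthogonality, the min-norm characterisation, the competitor algebra»; INTENT HOME/CLAIMS.log l.17506).

The flat assembly socket H5a (`NE3SlicePoincareAssembly`, owner, p226117) rests on four EXACT steps — (i) min-norm of slice fields in
their corner-trivial gauge orbit, (ii) Pythagoras for a co-closed `η`, (iii) the corner SPIKE field and its energy `≤ 4d·Σ‖θ‖²`, (iv) the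
competitor algebra — plus three ESTIMATES (H2 co-exact chain, H3 interpolant, H4 frame bound).  THIS FILE proves that the four exact steps
survive at EVERY unitary background `W` VERBATIM, with the flat coboundary `dPot ξ` replaced by the linearised gauge direction
`gaugeDir W ξ` (`BlockAveragePushDirGauge.gaugeDir`: `(x,μ) ↦ Ad_{W(x,μ)⁻¹} ξ(x) − ξ(x+e_μ)`) and the flat divergence by the covariant
backward divergence `NE3CovariantWeitzenbock.covDiv`, in the Hilbert–Schmidt currency `nhsNormSq`∕`hsR` of this lineage's
`NE3LandauOrbit` (Landau orthogonality `sum_hsR_gaugeDir`).  `Ad_W` is an HS isometry, so NO smallness, NO curvature bound and NO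
transport defect enters ANY of the four steps: in the curved assembly the background can act only through the co-exact chain for `η`
((μK-FR)) and through the interpolant term `gaugeDir W I = −dPot I + (Ad_{W⁻¹} − 1)·I` ((ζ-def), §4) — the two typed inequalities of
ρ-g21-4 (W5), which are NOT touched here.

CONTENT (all [folklore]; 0 sorry; 0 def):
§1 **`sum_hsR_gaugeDir_eq_zero_of_projLandauW`** — `M, N ≥ 1`, `W` unitary, `Y`, `ξ` `(M·N)`-periodic, `covDiv W Y (M•z + v) = 0` for
   `v ∈ periodBox M ∖ {0}`, `ξ (M•z) = 0` ⟹ `Σ_{x∈periodBox (M·N)} Σ_μ hsR (Y x μ) (gaugeDir W ξ x μ) = 0`;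
   **`sum_nhsNormSq_add_gaugeDir_eq_of_projLandauW`** (Pythagoras), **`sum_nhsNormSq_le_of_projLandauW`** (min-norm on T_pt(W)).
§1b THE FRAME-FREE SLICE T_♮(W) (slice of record for the curved step, ρ-g22-2 (V3)): `sum_hsR_eq_zero_of_blockConst`,
   **`sum_hsR_gaugeDir_eq_zero_of_frameFreeSliceW`** (covariant divergence CONSTANT on each block off its corner, generator `ξ ∈ Ξ₀₀` =
   corner-trivial with zero block sums ⟹ orthogonality; the W ≠ 1 twin of (73S) `sum_inner_dPot_eq_zero_of_slice`),
   **`sum_nhsNormSq_le_of_frameFreeSliceW`** (Pythagoras ∧ min-norm in the `gaugeDir W Ξ₀₀`-orbit).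
§1c the same in the TRANSPORTED convention (covariantly-constant block divergence `covDiv W Y (M•z+v) = Ad_{T z v}(c z)` w.r.t. ANY unitary
   transports `T`, generator with zero transported block means): `sum_hsR_eq_zero_of_blockCovConst`, **`sum_hsR_gaugeDir_eq_zero_of_frameFreeSliceW'`**
   (orthogonality ∧ min-norm) — whichever block-constancy convention the Set `T_♮(W)` of row K0 adopts, S6 is served.
§2 Pythagoras for a covariantly co-closed `η` against every periodic gauge direction is `NE3LandauOrbit.sum_nhsNormSq_add_gaugeDir` (pointer).
§3 THE CURVED SPIKES: `nhsNormSq_gaugeDir_le` (`nhsNormSq (gaugeDir W S x μ) ≤ 2·(nhsNormSq (S x) + nhsNormSq (S (x+e_μ)))`, any unitary `W`),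
   `sum_nhsNormSq_spike_eq` (mass: one site per block), **`sum_nhsNormSq_gaugeDir_spike_le`**:
   `Σ_{x∈periodBox (M·N)} Σ_μ nhsNormSq (gaugeDir W S x μ) ≤ 4d·Σ_{z∈periodBox N} nhsNormSq (θ z)`, `S = θ∘cdiv M − cornerGauge M θ`
   (the owner's `spike_corner`∕`spike_off_corner`∕`spike_add_period`, generic `𝔸`, BY NAME).
§4 competitor algebra `orbit_competitor` (`(η + gaugeDir W ζ) + gaugeDir W (ζ̃ − ζ) = η + gaugeDir W ζ̃`) and the defect split of a generator's
   gauge direction `gaugeDir_eq_neg_dPot_add_defect` (`gaugeDir W I x μ = −dPot I x μ + (Ad_{W(x,μ)⁻¹} (I x) − I x)`) with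
   `nhsNormSq_gaugeDir_le_dPot_add_defect` (`≤ 2·nhsNormSq (dPot I x μ) + 2·nhsNormSq (Ad_{W(x,μ)⁻¹}(I x) − I x)`) — the socket where (ζ-def) plugs.

HONEST: exact finite-torus linear algebra on OUR frame (no estimate with content); nothing about Bałaban's minimisers; (P♮)∕(ML_w) at
W ≠ 1, (μK-FR), (ζ-def), T-E_w, NE3 NOT proved; spine PROVED 0∕9; finite T⁴ rung (B)+1 — NOT infinite volume, NOT mass gap, NOT BetaPertH,
NOT Clay.  PLACEMENT: `Summits/QuantumFields/BalabanUV/`.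
-/

set_option autoImplicit false

open scoped BigOperators Matrix.Norms.L2Operator
open Finset

namespace Summit.QuantumFields.BalabanUV.T4Continuum.NE3CovariantSliceOrthogonality

open Literature.MathematicalPhysics.QuantumFieldTheory.Balaban1983to89
open B7Prop1Explicit B7Prop2Explicit MatrixNorms
open T4AveragingDeficitWall (IsUnitaryCfg Ad)
open T4AveragingDeficitWallBoundary (periodBox mem_periodBox sum_periodBox_shift)
open AveragingDeficitPeriodicCounting (IsPeriodicDir)
open BlockAveragePushDirGauge (gaugeDir)
open NE3TangentNoGoWords (dPot)
open NE3CovariantCalculus (hsR hsR_sum_right hsR_Ad_left nhsNormSq_sub_le)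
open AveragingDeficitHSInner (nhsNormSq_Ad)
open NE3CovariantWeitzenbock (covDiv)
open NE3LandauOrbit (sum_hsR_gaugeDir hsR_zero_left hsR_zero_right nhsNormSq_add)
open NE3FramePotGauge (cornerGauge)
open NE3BlockLineAverage (sum_periodBox_blocks)
open NE3SlicePoincareAssembly (spike_corner spike_off_corner spike_add_period)
open SkeletonLattice (cdiv)

noncomputable section

variable {d : ℕ} {n : Type*} [Fintype n] [DecidableEq n]

/-! ## §1 Min-norm on the curved projected Landau slice: `Σ‖Y‖² ≤ Σ‖Y + gaugeDir W ξ‖²` for corner-trivial `ξ` -/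

/-- **ORTHOGONALITY ON THE CURVED PROJECTED LANDAU SLICE**: `M, N ≥ 1`; `W` unitary; `Y`, `ξ` `(M·N)`-periodic; if the covariant divergence
of `Y` vanishes on every block OFF its corner and `ξ` vanishes AT the corners, then `Σ_x Σ_μ hsR (Y x μ) (gaugeDir W ξ x μ) = 0`. [folklore] -/
theorem sum_hsR_gaugeDir_eq_zero_of_projLandauW {M : ℕ} (hM : 1 ≤ M) {N : ℕ} (hN : 1 ≤ N)
    {W : Site d → Fin d → (Matrix n n ℂ)ˣ} (hWu : IsUnitaryCfg W)
    {Y : Site d → Fin d → Matrix n n ℂ} (hY : IsPeriodicDir Y ((M * N : ℕ) : ℤ))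
    {ξ : Site d → Matrix n n ℂ} (hξ : ∀ (x : Site d) (τ : Fin d), ξ (x + ((M * N : ℕ) : ℤ) • e τ) = ξ x)
    (hdiv : ∀ (z v : Site d), v ∈ periodBox (d := d) M → v ≠ 0 → covDiv W Y ((M : ℤ) • z + v) = 0)
    (hξc : ∀ z : Site d, ξ ((M : ℤ) • z) = 0) :
    ∑ x ∈ periodBox (d := d) (M * N), ∑ μ : Fin d, hsR (Y x μ) (gaugeDir W ξ x μ) = 0 := by
  have hMN : 1 ≤ M * N := Nat.one_le_iff_ne_zero.mpr (Nat.mul_ne_zero (by omega) (by omega))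
  rw [sum_hsR_gaugeDir hMN hWu hY hξ, ← sum_periodBox_blocks M N hM (fun x => hsR (covDiv W Y x) (ξ x))]
  refine Finset.sum_eq_zero fun z _ => Finset.sum_eq_zero fun v hv => ?_
  by_cases h0 : v = 0
  · subst h0; rw [add_zero, hξc z, hsR_zero_right]
  · rw [hdiv z v hv h0, hsR_zero_left]

/-- **PYTHAGORAS ON THE CURVED PROJECTED LANDAU SLICE**: under the hypotheses of `sum_hsR_gaugeDir_eq_zero_of_projLandauW`,
`Σ nhsNormSq (Y + gaugeDir W ξ) = Σ nhsNormSq Y + Σ nhsNormSq (gaugeDir W ξ)` over `periodBox (M·N)`. [folklore] -/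
theorem sum_nhsNormSq_add_gaugeDir_eq_of_projLandauW {M : ℕ} (hM : 1 ≤ M) {N : ℕ} (hN : 1 ≤ N)
    {W : Site d → Fin d → (Matrix n n ℂ)ˣ} (hWu : IsUnitaryCfg W)
    {Y : Site d → Fin d → Matrix n n ℂ} (hY : IsPeriodicDir Y ((M * N : ℕ) : ℤ))
    {ξ : Site d → Matrix n n ℂ} (hξ : ∀ (x : Site d) (τ : Fin d), ξ (x + ((M * N : ℕ) : ℤ) • e τ) = ξ x)
    (hdiv : ∀ (z v : Site d), v ∈ periodBox (d := d) M → v ≠ 0 → covDiv W Y ((M : ℤ) • z + v) = 0)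
    (hξc : ∀ z : Site d, ξ ((M : ℤ) • z) = 0) :
    ∑ x ∈ periodBox (d := d) (M * N), ∑ μ : Fin d, nhsNormSq (Y x μ + gaugeDir W ξ x μ)
      = ∑ x ∈ periodBox (d := d) (M * N), ∑ μ : Fin d, nhsNormSq (Y x μ)
        + ∑ x ∈ periodBox (d := d) (M * N), ∑ μ : Fin d, nhsNormSq (gaugeDir W ξ x μ) := by
  have horth := sum_hsR_gaugeDir_eq_zero_of_projLandauW hM hN hWu hY hξ hdiv hξc
  simp_rw [nhsNormSq_add, Finset.sum_add_distrib, ← Finset.mul_sum]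
  rw [horth, mul_zero, add_zero]

/-- **CURVED SLICE FIELDS ARE HS-NORM-MINIMAL IN THEIR CORNER-TRIVIAL LINEARISED GAUGE ORBIT**:
`Σ nhsNormSq (Y x μ) ≤ Σ nhsNormSq (Y x μ + gaugeDir W ξ x μ)` — at EVERY unitary background `W`. [folklore] -/
theorem sum_nhsNormSq_le_of_projLandauW {M : ℕ} (hM : 1 ≤ M) {N : ℕ} (hN : 1 ≤ N)
    {W : Site d → Fin d → (Matrix n n ℂ)ˣ} (hWu : IsUnitaryCfg W)
    {Y : Site d → Fin d → Matrix n n ℂ} (hY : IsPeriodicDir Y ((M * N : ℕ) : ℤ))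
    {ξ : Site d → Matrix n n ℂ} (hξ : ∀ (x : Site d) (τ : Fin d), ξ (x + ((M * N : ℕ) : ℤ) • e τ) = ξ x)
    (hdiv : ∀ (z v : Site d), v ∈ periodBox (d := d) M → v ≠ 0 → covDiv W Y ((M : ℤ) • z + v) = 0)
    (hξc : ∀ z : Site d, ξ ((M : ℤ) • z) = 0) :
    ∑ x ∈ periodBox (d := d) (M * N), ∑ μ : Fin d, nhsNormSq (Y x μ)
      ≤ ∑ x ∈ periodBox (d := d) (M * N), ∑ μ : Fin d, nhsNormSq (Y x μ + gaugeDir W ξ x μ) := by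
  rw [sum_nhsNormSq_add_gaugeDir_eq_of_projLandauW hM hN hWu hY hξ hdiv hξc]
  have h : 0 ≤ ∑ x ∈ periodBox (d := d) (M * N), ∑ μ : Fin d, nhsNormSq (gaugeDir W ξ x μ) :=
    Finset.sum_nonneg fun _ _ => Finset.sum_nonneg fun _ _ => nhsNormSq_nonneg _
  linarith

/-! ## §1b Min-norm on the curved FRAME-FREE slice T_♮(W): blockwise-CONSTANT covariant divergence ⟂ `gaugeDir W Ξ₀₀` -/

/-- Block bookkeeping: if `D` equals the constant `c z` on the block of `z` off its corner and `ξ` is corner-trivial with zero block sums,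
then `Σ_{x∈periodBox (M·N)} hsR (D x) (ξ x) = 0`. [folklore] -/
theorem sum_hsR_eq_zero_of_blockConst {M : ℕ} (hM : 1 ≤ M) (N : ℕ) (D ξ c : Site d → Matrix n n ℂ)
    (hD : ∀ (z v : Site d), v ∈ periodBox (d := d) M → v ≠ 0 → D ((M : ℤ) • z + v) = c z)
    (hξc : ∀ z : Site d, ξ ((M : ℤ) • z) = 0)
    (hξs : ∀ z : Site d, ∑ v ∈ periodBox (d := d) M, ξ ((M : ℤ) • z + v) = 0) :
    ∑ x ∈ periodBox (d := d) (M * N), hsR (D x) (ξ x) = 0 := by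
  rw [← sum_periodBox_blocks M N hM (fun x => hsR (D x) (ξ x))]
  refine Finset.sum_eq_zero fun z _ => ?_
  have hterm : ∀ v ∈ periodBox (d := d) M, hsR (D ((M : ℤ) • z + v)) (ξ ((M : ℤ) • z + v))
      = hsR (c z) (ξ ((M : ℤ) • z + v)) := by
    intro v hv
    by_cases h0 : v = 0
    · subst h0; rw [add_zero, hξc z, hsR_zero_right, hsR_zero_right]
    · rw [hD z v hv h0]
  rw [Finset.sum_congr rfl hterm, ← hsR_sum_right, hξs z, hsR_zero_right]

/-- **ORTHOGONALITY ON THE CURVED FRAME-FREE SLICE T_♮(W)**: `M, N ≥ 1`; `W` unitary; `Y`, `ξ` `(M·N)`-periodic; if the covariant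
divergence of `Y` is CONSTANT on every block off its corner (`covDiv W Y (M•z + v) = c z`, `v ≠ 0`) and the generator `ξ` is corner-trivial
with zero block sums (`ξ ∈ Ξ₀₀`), then `Σ_x Σ_μ hsR (Y x μ) (gaugeDir W ξ x μ) = 0` (the W ≠ 1 twin of (73S) `sum_inner_dPot_eq_zero_of_slice`).
[folklore] -/
theorem sum_hsR_gaugeDir_eq_zero_of_frameFreeSliceW {M : ℕ} (hM : 1 ≤ M) {N : ℕ} (hN : 1 ≤ N)
    {W : Site d → Fin d → (Matrix n n ℂ)ˣ} (hWu : IsUnitaryCfg W)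
    {Y : Site d → Fin d → Matrix n n ℂ} (hY : IsPeriodicDir Y ((M * N : ℕ) : ℤ))
    {ξ : Site d → Matrix n n ℂ} (hξ : ∀ (x : Site d) (τ : Fin d), ξ (x + ((M * N : ℕ) : ℤ) • e τ) = ξ x)
    (c : Site d → Matrix n n ℂ)
    (hdiv : ∀ (z v : Site d), v ∈ periodBox (d := d) M → v ≠ 0 → covDiv W Y ((M : ℤ) • z + v) = c z)
    (hξc : ∀ z : Site d, ξ ((M : ℤ) • z) = 0)
    (hξs : ∀ z : Site d, ∑ v ∈ periodBox (d := d) M, ξ ((M : ℤ) • z + v) = 0) :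
    ∑ x ∈ periodBox (d := d) (M * N), ∑ μ : Fin d, hsR (Y x μ) (gaugeDir W ξ x μ) = 0 := by
  have hMN : 1 ≤ M * N := Nat.one_le_iff_ne_zero.mpr (Nat.mul_ne_zero (by omega) (by omega))
  rw [sum_hsR_gaugeDir hMN hWu hY hξ]
  exact sum_hsR_eq_zero_of_blockConst hM N (covDiv W Y) ξ c hdiv hξc hξs

/-- **PYTHAGORAS ∕ MIN-NORM ON THE CURVED FRAME-FREE SLICE**: under the hypotheses of `sum_hsR_gaugeDir_eq_zero_of_frameFreeSliceW`,
`Σ nhsNormSq (Y + gaugeDir W ξ) = Σ nhsNormSq Y + Σ nhsNormSq (gaugeDir W ξ)`, hence `Σ nhsNormSq Y ≤ Σ nhsNormSq (Y + gaugeDir W ξ)` —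
T_♮(W) fields are HS-norm-minimal in their `gaugeDir W Ξ₀₀`-orbit, at EVERY unitary `W`. [folklore] -/
theorem sum_nhsNormSq_le_of_frameFreeSliceW {M : ℕ} (hM : 1 ≤ M) {N : ℕ} (hN : 1 ≤ N)
    {W : Site d → Fin d → (Matrix n n ℂ)ˣ} (hWu : IsUnitaryCfg W)
    {Y : Site d → Fin d → Matrix n n ℂ} (hY : IsPeriodicDir Y ((M * N : ℕ) : ℤ))
    {ξ : Site d → Matrix n n ℂ} (hξ : ∀ (x : Site d) (τ : Fin d), ξ (x + ((M * N : ℕ) : ℤ) • e τ) = ξ x)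
    (c : Site d → Matrix n n ℂ)
    (hdiv : ∀ (z v : Site d), v ∈ periodBox (d := d) M → v ≠ 0 → covDiv W Y ((M : ℤ) • z + v) = c z)
    (hξc : ∀ z : Site d, ξ ((M : ℤ) • z) = 0)
    (hξs : ∀ z : Site d, ∑ v ∈ periodBox (d := d) M, ξ ((M : ℤ) • z + v) = 0) :
    ∑ x ∈ periodBox (d := d) (M * N), ∑ μ : Fin d, nhsNormSq (Y x μ + gaugeDir W ξ x μ)
        = ∑ x ∈ periodBox (d := d) (M * N), ∑ μ : Fin d, nhsNormSq (Y x μ)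
          + ∑ x ∈ periodBox (d := d) (M * N), ∑ μ : Fin d, nhsNormSq (gaugeDir W ξ x μ)
      ∧ ∑ x ∈ periodBox (d := d) (M * N), ∑ μ : Fin d, nhsNormSq (Y x μ)
        ≤ ∑ x ∈ periodBox (d := d) (M * N), ∑ μ : Fin d, nhsNormSq (Y x μ + gaugeDir W ξ x μ) := by
  have horth := sum_hsR_gaugeDir_eq_zero_of_frameFreeSliceW hM hN hWu hY hξ c hdiv hξc hξs
  have hpy : ∑ x ∈ periodBox (d := d) (M * N), ∑ μ : Fin d, nhsNormSq (Y x μ + gaugeDir W ξ x μ)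
      = ∑ x ∈ periodBox (d := d) (M * N), ∑ μ : Fin d, nhsNormSq (Y x μ)
        + ∑ x ∈ periodBox (d := d) (M * N), ∑ μ : Fin d, nhsNormSq (gaugeDir W ξ x μ) := by
    simp_rw [nhsNormSq_add, Finset.sum_add_distrib, ← Finset.mul_sum]
    rw [horth, mul_zero, add_zero]
  refine ⟨hpy, ?_⟩
  rw [hpy]
  have h : 0 ≤ ∑ x ∈ periodBox (d := d) (M * N), ∑ μ : Fin d, nhsNormSq (gaugeDir W ξ x μ) :=
    Finset.sum_nonneg fun _ _ => Finset.sum_nonneg fun _ _ => nhsNormSq_nonneg _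
  linarith

/-! ## §1c The same with TRANSPORTED block constants ∕ transported block means (any transport convention `T`) -/

/-- Block bookkeeping, transported form: if `D (M•z + v) = Ad_{T z v} (c z)` off the corner (a COVARIANTLY constant block value, for ANY
family of unitary transports `T z v`) and `ξ` is corner-trivial with zero TRANSPORTED block sums `Σ_v Ad_{(T z v)⁻¹} ξ(M•z + v) = 0`, then
`Σ_{x∈periodBox (M·N)} hsR (D x) (ξ x) = 0`. [folklore] -/
theorem sum_hsR_eq_zero_of_blockCovConst {M : ℕ} (hM : 1 ≤ M) (N : ℕ) (D ξ c : Site d → Matrix n n ℂ)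
    (T : Site d → Site d → (Matrix n n ℂ)ˣ) (hT : ∀ z v, T z v ∈ unitaryUnits (Matrix n n ℂ))
    (hD : ∀ (z v : Site d), v ∈ periodBox (d := d) M → v ≠ 0 → D ((M : ℤ) • z + v) = Ad (T z v) (c z))
    (hξc : ∀ z : Site d, ξ ((M : ℤ) • z) = 0)
    (hξs : ∀ z : Site d, ∑ v ∈ periodBox (d := d) M, Ad (T z v)⁻¹ (ξ ((M : ℤ) • z + v)) = 0) :
    ∑ x ∈ periodBox (d := d) (M * N), hsR (D x) (ξ x) = 0 := by
  rw [← sum_periodBox_blocks M N hM (fun x => hsR (D x) (ξ x))]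
  refine Finset.sum_eq_zero fun z _ => ?_
  have hterm : ∀ v ∈ periodBox (d := d) M, hsR (D ((M : ℤ) • z + v)) (ξ ((M : ℤ) • z + v))
      = hsR (c z) (Ad (T z v)⁻¹ (ξ ((M : ℤ) • z + v))) := by
    intro v hv
    by_cases h0 : v = 0
    · subst h0; rw [add_zero, hξc z, hsR_zero_right]
      unfold Ad; rw [Matrix.mul_zero, Matrix.zero_mul, hsR_zero_right]
    · rw [hD z v hv h0, hsR_Ad_left (hT z v)]
  rw [Finset.sum_congr rfl hterm, ← hsR_sum_right, hξs z, hsR_zero_right]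

/-- **ORTHOGONALITY ON T_♮(W), TRANSPORTED CONVENTION**: `covDiv W Y (M•z + v) = Ad_{T z v} (c z)` off the corners (covariantly constant
block divergence w.r.t. any unitary transports `T`) and `ξ` corner-trivial with zero transported block means ⟹
`Σ_x Σ_μ hsR (Y x μ) (gaugeDir W ξ x μ) = 0`; hence Pythagoras and min-norm exactly as in §1b. [folklore] -/
theorem sum_hsR_gaugeDir_eq_zero_of_frameFreeSliceW' {M : ℕ} (hM : 1 ≤ M) {N : ℕ} (hN : 1 ≤ N)
    {W : Site d → Fin d → (Matrix n n ℂ)ˣ} (hWu : IsUnitaryCfg W)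
    {Y : Site d → Fin d → Matrix n n ℂ} (hY : IsPeriodicDir Y ((M * N : ℕ) : ℤ))
    {ξ : Site d → Matrix n n ℂ} (hξ : ∀ (x : Site d) (τ : Fin d), ξ (x + ((M * N : ℕ) : ℤ) • e τ) = ξ x)
    (c : Site d → Matrix n n ℂ) (T : Site d → Site d → (Matrix n n ℂ)ˣ) (hT : ∀ z v, T z v ∈ unitaryUnits (Matrix n n ℂ))
    (hdiv : ∀ (z v : Site d), v ∈ periodBox (d := d) M → v ≠ 0 → covDiv W Y ((M : ℤ) • z + v) = Ad (T z v) (c z))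
    (hξc : ∀ z : Site d, ξ ((M : ℤ) • z) = 0)
    (hξs : ∀ z : Site d, ∑ v ∈ periodBox (d := d) M, Ad (T z v)⁻¹ (ξ ((M : ℤ) • z + v)) = 0) :
    ∑ x ∈ periodBox (d := d) (M * N), ∑ μ : Fin d, hsR (Y x μ) (gaugeDir W ξ x μ) = 0
      ∧ ∑ x ∈ periodBox (d := d) (M * N), ∑ μ : Fin d, nhsNormSq (Y x μ)
        ≤ ∑ x ∈ periodBox (d := d) (M * N), ∑ μ : Fin d, nhsNormSq (Y x μ + gaugeDir W ξ x μ) := by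
  have hMN : 1 ≤ M * N := Nat.one_le_iff_ne_zero.mpr (Nat.mul_ne_zero (by omega) (by omega))
  have horth : ∑ x ∈ periodBox (d := d) (M * N), ∑ μ : Fin d, hsR (Y x μ) (gaugeDir W ξ x μ) = 0 := by
    rw [sum_hsR_gaugeDir hMN hWu hY hξ]
    exact sum_hsR_eq_zero_of_blockCovConst hM N (covDiv W Y) ξ c T hT hdiv hξc hξs
  refine ⟨horth, ?_⟩
  have hpy : ∑ x ∈ periodBox (d := d) (M * N), ∑ μ : Fin d, nhsNormSq (Y x μ + gaugeDir W ξ x μ)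
      = ∑ x ∈ periodBox (d := d) (M * N), ∑ μ : Fin d, nhsNormSq (Y x μ)
        + ∑ x ∈ periodBox (d := d) (M * N), ∑ μ : Fin d, nhsNormSq (gaugeDir W ξ x μ) := by
    simp_rw [nhsNormSq_add, Finset.sum_add_distrib, ← Finset.mul_sum]
    rw [horth, mul_zero, add_zero]
  rw [hpy]
  have h : 0 ≤ ∑ x ∈ periodBox (d := d) (M * N), ∑ μ : Fin d, nhsNormSq (gaugeDir W ξ x μ) :=
    Finset.sum_nonneg fun _ _ => Finset.sum_nonneg fun _ _ => nhsNormSq_nonneg _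
  linarith

/-! ## §3 The curved corner spikes: `gaugeDir W (θ∘cdiv M − cornerGauge M θ)` has energy `≤ 4d·Σ‖θ‖²` at every unitary `W` -/

omit [DecidableEq n] in
/-- `nhsNormSq 0 = 0`. [folklore] -/
theorem nhsNormSq_zero : nhsNormSq (0 : Matrix n n ℂ) = 0 := by
  simp [nhsNormSq]

/-- **ONE BOND OF A GAUGE DIRECTION** (unitary `W`): `nhsNormSq (gaugeDir W S x μ) ≤ 2·(nhsNormSq (S x) + nhsNormSq (S (x+e_μ)))` —
`Ad_{W(x,μ)⁻¹}` is an HS isometry. [folklore] -/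
theorem nhsNormSq_gaugeDir_le {W : Site d → Fin d → (Matrix n n ℂ)ˣ} (hWu : IsUnitaryCfg W) (S : Site d → Matrix n n ℂ)
    (x : Site d) (μ : Fin d) :
    nhsNormSq (gaugeDir W S x μ) ≤ 2 * (nhsNormSq (S x) + nhsNormSq (S (x + e μ))) := by
  unfold gaugeDir
  have hu : (W x μ)⁻¹ ∈ unitaryUnits (Matrix n n ℂ) := (unitaryUnits (Matrix n n ℂ)).inv_mem (hWu x μ)
  have h := nhsNormSq_sub_le (Ad (W x μ)⁻¹ (S x)) (S (x + e μ))
  rwa [nhsNormSq_Ad hu] at h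

/-- **THE HS-MASS OF THE SPIKE FIELD** (matrix values): `Σ_{x∈periodBox (M·N)} nhsNormSq (spike x) = Σ_{z∈periodBox N} nhsNormSq (θ z)`. [folklore] -/
theorem sum_nhsNormSq_spike_eq {M : ℕ} (hM : 1 ≤ M) (N : ℕ) (θ : Site d → Matrix n n ℂ) :
    ∑ x ∈ periodBox (d := d) (M * N), nhsNormSq (θ (cdiv M x) - cornerGauge M θ x)
      = ∑ z ∈ periodBox (d := d) N, nhsNormSq (θ z) := by
  rw [← sum_periodBox_blocks M N hM (fun x => nhsNormSq (θ (cdiv M x) - cornerGauge M θ x))]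
  refine Finset.sum_congr rfl fun z _ => ?_
  have h0mem : (0 : Site d) ∈ periodBox (d := d) M := by
    rw [mem_periodBox]; intro i; simp only [Pi.zero_apply]; exact ⟨le_rfl, by exact_mod_cast (by omega : 0 < M)⟩
  rw [← Finset.add_sum_erase _ _ h0mem, add_zero, spike_corner hM θ z]
  have hrest : ∑ v ∈ (periodBox (d := d) M).erase 0,
      nhsNormSq (θ (cdiv M ((M : ℤ) • z + v)) - cornerGauge M θ ((M : ℤ) • z + v)) = 0 := by
    refine Finset.sum_eq_zero fun v hv => ?_
    rw [Finset.mem_erase] at hv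
    rw [spike_off_corner M θ z hv.2 hv.1, nhsNormSq_zero]
  rw [hrest, add_zero]

/-- **THE ENERGY OF THE CURVED SPIKE DIRECTION** (matrix values, ANY unitary `W`): `M, N ≥ 1`, `θ` `N`-periodic ⇒
`Σ_{x∈periodBox (M·N)} Σ_μ nhsNormSq (gaugeDir W spike x μ) ≤ 4d·Σ_{z∈periodBox N} nhsNormSq (θ z)` — «corner spikes are cheap» survives
curvature verbatim (bondwise `2a² + 2b²` after the HS isometry `Ad_{W⁻¹}`, shift invariance of the torus sum). [folklore] -/
theorem sum_nhsNormSq_gaugeDir_spike_le {M : ℕ} (hM : 1 ≤ M) {N : ℕ} (hN : 1 ≤ N)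
    {W : Site d → Fin d → (Matrix n n ℂ)ˣ} (hWu : IsUnitaryCfg W) (θ : Site d → Matrix n n ℂ)
    (hθ : ∀ (z : Site d) (τ : Fin d), θ (z + (N : ℤ) • e τ) = θ z) :
    ∑ x ∈ periodBox (d := d) (M * N), ∑ μ : Fin d, nhsNormSq (gaugeDir W (fun y => θ (cdiv M y) - cornerGauge M θ y) x μ)
      ≤ 4 * d * ∑ z ∈ periodBox (d := d) N, nhsNormSq (θ z) := by
  have hMN : 1 ≤ M * N := Nat.one_le_iff_ne_zero.mpr (Nat.mul_ne_zero (by omega) (by omega))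
  set S : Site d → Matrix n n ℂ := fun y => θ (cdiv M y) - cornerGauge M θ y with hSdef
  have hSper : ∀ (x : Site d) (τ : Fin d), S (x + ((M * N : ℕ) : ℤ) • e τ) = S x := fun x τ => by
    simp only [hSdef]; exact spike_add_period hM hθ x τ
  have hmass : ∑ x ∈ periodBox (d := d) (M * N), nhsNormSq (S x) = ∑ z ∈ periodBox (d := d) N, nhsNormSq (θ z) := by
    simp only [hSdef]; exact sum_nhsNormSq_spike_eq hM N θ
  have hpt : ∀ (x : Site d) (μ : Fin d), nhsNormSq (gaugeDir W S x μ) ≤ 2 * nhsNormSq (S x) + 2 * nhsNormSq (S (x + e μ)) := by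
    intro x μ; have h := nhsNormSq_gaugeDir_le hWu S x μ; linarith
  have hshift : ∀ μ : Fin d, ∑ x ∈ periodBox (d := d) (M * N), nhsNormSq (S (x + e μ))
      = ∑ x ∈ periodBox (d := d) (M * N), nhsNormSq (S x) := fun μ =>
    sum_periodBox_shift (M * N) hMN (g := fun x => nhsNormSq (S x)) (fun x τ => by rw [hSper]) (e μ)
  calc ∑ x ∈ periodBox (d := d) (M * N), ∑ μ : Fin d, nhsNormSq (gaugeDir W S x μ)
      ≤ ∑ x ∈ periodBox (d := d) (M * N), ∑ μ : Fin d, (2 * nhsNormSq (S x) + 2 * nhsNormSq (S (x + e μ))) :=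
        Finset.sum_le_sum fun x _ => Finset.sum_le_sum fun μ _ => hpt x μ
    _ = 2 * (d * ∑ x ∈ periodBox (d := d) (M * N), nhsNormSq (S x))
          + 2 * ∑ μ : Fin d, ∑ x ∈ periodBox (d := d) (M * N), nhsNormSq (S (x + e μ)) := by
        rw [Finset.sum_comm]
        simp only [Finset.sum_add_distrib, Finset.mul_sum, Finset.sum_const, Finset.card_univ, Fintype.card_fin,
          nsmul_eq_mul]
        rw [Finset.sum_comm]
        ring
    _ = 4 * d * ∑ z ∈ periodBox (d := d) N, nhsNormSq (θ z) := by
        simp only [hshift, Finset.sum_const, Finset.card_univ, Fintype.card_fin, nsmul_eq_mul]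
        rw [hmass]
        ring

/-! ## §4 Competitor algebra and the defect split of a generator's gauge direction -/

/-- **COMPETITOR ALGEBRA**: `(η + gaugeDir W ζ) + gaugeDir W (ζ̃ − ζ) = η + gaugeDir W ζ̃` — moving along the linearised gauge orbit by
the generator `ζ̃ − ζ` replaces the gauge part's generator. [folklore] -/
theorem orbit_competitor (W : Site d → Fin d → (Matrix n n ℂ)ˣ) (η : Site d → Fin d → Matrix n n ℂ) (ζ ζ' : Site d → Matrix n n ℂ)
    (x : Site d) (μ : Fin d) :
    (η x μ + gaugeDir W ζ x μ) + gaugeDir W (fun y => ζ' y - ζ y) x μ = η x μ + gaugeDir W ζ' x μ := by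
  simp only [gaugeDir, Ad, Matrix.mul_sub, Matrix.sub_mul]
  abel

/-- **THE DEFECT SPLIT**: `gaugeDir W I x μ = −dPot I x μ + (Ad_{W(x,μ)⁻¹} (I x) − I x)` — flat coboundary plus the transport defect of
the generator at the bond's base point (the socket where (ζ-def) plugs). [folklore] -/
theorem gaugeDir_eq_neg_dPot_add_defect (W : Site d → Fin d → (Matrix n n ℂ)ˣ) (I : Site d → Matrix n n ℂ) (x : Site d) (μ : Fin d) :
    gaugeDir W I x μ = -dPot I x μ + (Ad (W x μ)⁻¹ (I x) - I x) := by
  simp only [gaugeDir, dPot]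
  abel

/-- … hence `nhsNormSq (gaugeDir W I x μ) ≤ 2·nhsNormSq (dPot I x μ) + 2·nhsNormSq (Ad_{W(x,μ)⁻¹} (I x) − I x)`. [folklore] -/
theorem nhsNormSq_gaugeDir_le_dPot_add_defect (W : Site d → Fin d → (Matrix n n ℂ)ˣ) (I : Site d → Matrix n n ℂ) (x : Site d)
    (μ : Fin d) :
    nhsNormSq (gaugeDir W I x μ) ≤ 2 * nhsNormSq (dPot I x μ) + 2 * nhsNormSq (Ad (W x μ)⁻¹ (I x) - I x) := by
  rw [gaugeDir_eq_neg_dPot_add_defect]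
  have h := nhsNormSq_add (-dPot I x μ) (Ad (W x μ)⁻¹ (I x) - I x)
  have h2 := nhsNormSq_sub_le (-dPot I x μ) (Ad (W x μ)⁻¹ (I x) - I x)
  rw [NE3CovariantCalculus.nhsNormSq_sub, NE3CovariantCalculus.nhsNormSq_neg] at h2
  rw [h, NE3CovariantCalculus.nhsNormSq_neg]
  -- `2·hsR a b ≤ nhs a + nhs b` from `0 ≤ nhs (a − b)`
  have h3 : 0 ≤ nhsNormSq (-dPot I x μ - (Ad (W x μ)⁻¹ (I x) - I x)) := nhsNormSq_nonneg _
  rw [NE3CovariantCalculus.nhsNormSq_sub, NE3CovariantCalculus.nhsNormSq_neg] at h3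
  have h4 : hsR (-dPot I x μ) (Ad (W x μ)⁻¹ (I x) - I x) = -hsR (dPot I x μ) (Ad (W x μ)⁻¹ (I x) - I x) := by
    rw [show -dPot I x μ = 0 - dPot I x μ by abel, NE3CovariantCalculus.hsR_sub_left, hsR_zero_left, zero_sub]
  rw [h4] at h3 ⊢
  linarith [nhsNormSq_nonneg (dPot I x μ), nhsNormSq_nonneg (Ad (W x μ)⁻¹ (I x) - I x)]

end

end Summit.QuantumFields.BalabanUV.T4Continuum.NE3CovariantSliceOrthogonality
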